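import Literature.AlgebraicGeometry.Hu2025.Proofs.S04ModelV.GoverningBinomials
import HarnessLib

/-!
# Hu 2025 row 105 — «every binomial of `𝓑^ngv` is ϱ-linear» (chunk p0032 l.5–7) DISCHARGED for every model datum (kernel; D-lane)

`C32L5_holds`: the non-governing binomials are ℘-binomials (`BngvIn ⊆ wpBinomials`), and a ℘-binomial `x̄_t x_{(s)} − x̄_s x_{(t)}`
(`rel s = rel t`) is weighted-homogeneous of degree `1` for its own block weight and `0` for every other (`isRhoLinear_wpBinomial`).
Bookkeeping on OUR typed carriers of rows 101/103/105 ([claim: Hu2025, status: under-review] statements are candidates, never asserted); nothing about the manuscript's mathematics is decided here. AI-written; weaker than expert review.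
-/

noncomputable section

namespace Literature.AlgebraicGeometry.Hu2025.Proofs.S04ModelV

open MvPolynomial Literature.AlgebraicGeometry.Hu2025.Statements.S04ModelV

universe u v w x

variable {k : Type u} [CommRing k] {σ : Type v} {T : Type w} {𝔗 : Type x}

/-- The block weight of the exponent of `x̄_a · x_{(b)}`: `1` on the block of `b`, `0` elsewhere. [cite: Hu2025, §4.1 Def. 4.3 (ϱ-linear) / §4.5 chunk p0032 l.5–7, chunks p0021 l.113–120 / p0032 l.5–7 (unrefereed preprint arXiv:2507.21400v1 under adjudication, D-0012/D-0089 — kernel support on OUR typed carriers of rows 103/105; nothing of the source asserted)] -/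
theorem weight_blockWeight_wpExp [DecidableEq 𝔗] (rel : T → 𝔗) (mono : T → (σ →₀ ℕ)) (F : 𝔗) (a b : T) :
    Finsupp.weight (blockWeight (σ := σ) rel F)
        (((mono a).mapDomain Sum.inl + Finsupp.single (Sum.inr b) 1 : σ ⊕ T →₀ ℕ)) =
      if rel b = F then 1 else 0 := by
  rw [map_add]
  have h1 : Finsupp.weight (blockWeight (σ := σ) rel F) ((mono a).mapDomain Sum.inl : σ ⊕ T →₀ ℕ) = 0 := by
    rw [Finsupp.weight_apply, Finsupp.sum_mapDomain_index (fun _ => by simp) (fun _ _ _ => by simp [add_mul])]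
    simp [blockWeight]
  have h2 : Finsupp.weight (blockWeight (σ := σ) rel F) (Finsupp.single (Sum.inr b : σ ⊕ T) 1) = if rel b = F then 1 else 0 := by
    rw [Finsupp.weight_apply, Finsupp.sum_single_index (by simp)]
    simp [blockWeight]
  rw [h1, h2, zero_add]

/-- **Every ℘-binomial is ϱ-linear**: `x̄_t x_{(s)} − x̄_s x_{(t)}` with `s, t` in one block has block degree `1` there and `0`
elsewhere. [cite: Hu2025, §4.1 Def. 4.3 (ϱ-linear) / §4.5 chunk p0032 l.5–7, chunks p0021 l.113–120 / p0032 l.5–7 (unrefereed preprint arXiv:2507.21400v1 under adjudication, D-0012/D-0089 — kernel support on OUR typed carriers of rows 103/105; nothing of the source asserted)] -/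
theorem isRhoLinear_wpBinomial [DecidableEq 𝔗] (rel : T → 𝔗) (mono : T → (σ →₀ ℕ)) {s t : T} (hst : rel s = rel t) :
    IsRhoLinear (k := k) (σ := σ) rel (wpBinomial (k := k) mono s t) := by
  intro F
  refine ⟨if rel s = F then 1 else 0, by split_ifs <;> omega, ?_⟩
  have h1 : IsWeightedHomogeneous (blockWeight (σ := σ) rel F)
      (monomial (((mono t).mapDomain Sum.inl + Finsupp.single (Sum.inr s) 1 : σ ⊕ T →₀ ℕ)) (1 : k))
      (if rel s = F then 1 else 0) :=
    isWeightedHomogeneous_monomial _ _ _ (weight_blockWeight_wpExp rel mono F t s)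
  have h2 : IsWeightedHomogeneous (blockWeight (σ := σ) rel F)
      (monomial (((mono s).mapDomain Sum.inl + Finsupp.single (Sum.inr t) 1 : σ ⊕ T →₀ ℕ)) (1 : k))
      (if rel s = F then 1 else 0) := by
    have := weight_blockWeight_wpExp (σ := σ) rel mono F s t
    rw [← hst] at this
    exact isWeightedHomogeneous_monomial _ _ _ this
  rw [wpBinomial_eq, ← mem_weightedHomogeneousSubmodule]
  exact Submodule.sub_mem _ ((mem_weightedHomogeneousSubmodule _ _ _ _).mpr h1)
    ((mem_weightedHomogeneousSubmodule _ _ _ _).mpr h2)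

/-- **`C32L5` holds** («every binomial of `𝓑^ngv` is ϱ-linear», chunk p0032 l.5–7) for every model datum: the non-governing
binomials are ℘-binomials, and every ℘-binomial is ϱ-linear. [cite: Hu2025, §4.1 Def. 4.3 (ϱ-linear) / §4.5 chunk p0032 l.5–7, chunks p0021 l.113–120 / p0032 l.5–7 (unrefereed preprint arXiv:2507.21400v1 under adjudication, D-0012/D-0089 — kernel support on OUR typed carriers of rows 103/105; nothing of the source asserted)] -/
theorem C32L5_holds : ∀ {k : Type u} [CommRing k] {σ : Type v} {T : Type w} {𝔗 : Type x} [DecidableEq 𝔗]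
    (rel : T → 𝔗) (mono : T → (σ →₀ ℕ)) (head : 𝔗 → T), C32L5 (k := k) (σ := σ) rel mono head := by
  intro k _ σ T 𝔗 _ rel mono head f hf
  obtain ⟨⟨s, t, hst, -, -, rfl, -⟩, -⟩ := hf
  exact isRhoLinear_wpBinomial (k := k) rel mono hst

end Literature.AlgebraicGeometry.Hu2025.Proofs.S04ModelV

end
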